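import Summits.QuantumAdvantage.QuantumAdvantage.Theorems.StickelbergerGridGaussPowerNotRealFrobenius

/-!
# QuantumAdvantage / StickelbergerGrid — `GaussPowerNotReal` (stmt-QuantumAdvantage-17352), part 2: the theorem

For valid `(p, ℓ, r)` the `ℓ`-th power `S^ℓ` of the order-`ℓ` Gauss sum `S = g(χ, ψ)` is NOT
real. This file identifies `S` with a Gauss sum (same construction as in
`StickelbergerGridGaussPowerIntegral.lean`) and runs the argument: `S^ℓ ∈ ℝ` ⇒ `S² = ζ^k p` ⇒
`G = g(χ², ψ) = ζ^k J(χ̄,χ̄) ∈ ℤ[ζ]`, `H = g(χ̄², ψ̄) = ζ^{ℓ−k} J(χ,χ) ∈ ℤ[ζ]`, `G H = p`; by the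
Frobenius congruence of part 1 (`StickelbergerGridGaussPowerNotRealFrobenius.lean`) both lie in
`p𝒪`, `𝒪 = ℤ[ζ, ξ]`, whence `1/p ∈ 𝒪` — impossible for a ring of algebraic integers.

HONEST FRAMING (block-2b rule): the value here is a closed ledger item (a classical lemma,
kernel-checked), not summit progress.

References: Ireland–Rosen, GTM 84 (1990), Ch. 8 §§2–3, Ch. 14 §3 [IrelandRosen1990];
Washington, GTM 83 (1997), §6.1 [Washington1997].
-/

set_option linter.dupNamespace false -- D-0017: single-problem summit ⇒ `QuantumAdvantage.QuantumAdvantage` by design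

namespace Summit.QuantumAdvantage.QuantumAdvantage.Theorems.GaussPowerNotReal

open Finset Summit.QuantumAdvantage.QuantumAdvantage.Theorems.GaussPowerIntegral

/-! ### The order-`ℓ` character behind `S` (as in `StickelbergerGridGaussPowerIntegral.lean`) -/

/-- For valid `(p, ℓ, r)`: the sum `S` of the route statement is the Gauss sum `g(χ, ψ)` of a
multiplicative character `χ ≠ 1` with `χ^ℓ = 1`, `χ(−1) = 1`, against the standard additive
character `ψ`. (Same construction as in `gaussPowerIntegral_proof`.) [Ireland–Rosen 1990, §8.2] -/
theorem exists_mulChar {p ℓ r : ℕ} [hpF : Fact p.Prime] (hℓ : ℓ.Prime) (hodd : Odd ℓ)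
    (hdiv : ℓ ∣ p - 1) (_hrp : r < p) (hrℓ : r ^ ℓ % p = 1) (hr1 : r % p ≠ 1) :
    ∃ χ : MulChar (ZMod p) ℂ, χ ≠ 1 ∧ χ ^ ℓ = 1 ∧ χ (-1) = 1 ∧
      (∑ x ∈ Finset.Icc 1 (p - 1), ∑ j ∈ Finset.range ℓ,
        if r ^ j % p = x ^ ((p - 1) / ℓ) % p then
          Complex.exp (2 * Real.pi * Complex.I * ((j : ℂ) / (ℓ : ℂ) + (x : ℂ) / (p : ℂ))) else 0) =
      gaussSum χ (ZMod.stdAddChar (N := p)) := by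
  classical
  have hp := hpF.out
  haveI hℓF : Fact ℓ.Prime := ⟨hℓ⟩
  have hℓ3 : 3 ≤ ℓ := by
    have h2 := hℓ.two_le
    rcases hodd with ⟨k, hk⟩
    omega
  obtain ⟨n, hn⟩ : ∃ n, p - 1 = ℓ * n := hdiv
  have hp2 := hp.two_le
  have hn0 : 0 < n := by
    rcases Nat.eq_zero_or_pos n with h | h
    · rw [h, mul_zero] at hn; omega
    · exact h
  have hndef : (p - 1) / ℓ = n := by
    rw [hn, Nat.mul_div_cancel_left _ hℓ.pos]
  have hp3 : 3 ≤ p := by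
    have h1 : 3 ≤ ℓ * n := le_trans hℓ3 (Nat.le_mul_of_pos_right _ hn0)
    omega
  have hneven : Even n := by
    have hpodd : p % 2 = 1 := Nat.odd_iff.1 (hp.odd_of_ne_two (by omega))
    obtain ⟨k, hk⟩ := hodd
    rcases Nat.even_or_odd n with h | ⟨m, hm⟩
    · exact h
    · exfalso
      rw [hk, hm] at hn
      have : (p - 1) % 2 = 0 := by omega
      rw [hn] at this
      ring_nf at this
      omega
  rw [hndef]
  set ζ : ℂ := Complex.exp (2 * Real.pi * Complex.I / ℓ) with hζ_def
  have hζ : IsPrimitiveRoot ζ ℓ := Complex.isPrimitiveRoot_exp ℓ hℓ.ne_zero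
  have hζℓ : ζ ^ ℓ = 1 := hζ.pow_eq_one
  set rb : ZMod p := (r : ZMod p) with hrb_def
  have hrbℓ : rb ^ ℓ = 1 := by
    have h : ((r ^ ℓ : ℕ) : ZMod p) = ((1 : ℕ) : ZMod p) := by
      rw [ZMod.natCast_eq_natCast_iff', hrℓ, Nat.mod_eq_of_lt hp.one_lt]
    rw [Nat.cast_pow, Nat.cast_one] at h
    exact h
  have hrb1 : rb ≠ 1 := by
    intro h
    have h' : ((r : ℕ) : ZMod p) = ((1 : ℕ) : ZMod p) := by rw [Nat.cast_one]; exact h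
    rw [ZMod.natCast_eq_natCast_iff', Nat.mod_eq_of_lt hp.one_lt] at h'
    exact hr1 h'
  have hrbprim : IsPrimitiveRoot rb ℓ := by
    rw [← orderOf_eq_prime hrbℓ hrb1]
    exact IsPrimitiveRoot.orderOf rb
  obtain ⟨g, hg⟩ := IsCyclic.exists_generator (α := (ZMod p)ˣ)
  have hcard : Fintype.card (ZMod p)ˣ = p - 1 := ZMod.card_units p
  have horder : orderOf g = p - 1 := by
    rw [orderOf_eq_card_of_forall_mem_zpowers hg, Nat.card_eq_fintype_card, hcard]
  have hg0 : (g : ZMod p) ≠ 0 := Units.ne_zero g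
  set ρ : ZMod p := (g : ZMod p) ^ n with hρ_def
  clear_value ρ
  have hρℓ : ρ ^ ℓ = 1 := by
    rw [hρ_def, ← pow_mul, mul_comm, ← hn]
    exact ZMod.pow_card_sub_one_eq_one hg0
  have hρ1 : ρ ≠ 1 := by
    intro h
    have hu : g ^ n = 1 :=
      Units.ext (by rw [Units.val_pow_eq_pow_val, Units.val_one, ← hρ_def]; exact h)
    refine pow_ne_one_of_lt_orderOf hn0.ne' ?_ hu
    rw [horder, hn]
    nlinarith
  have hρprim : IsPrimitiveRoot ρ ℓ := by
    rw [← orderOf_eq_prime hρℓ hρ1]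
    exact IsPrimitiveRoot.orderOf ρ
  haveI : NeZero ℓ := ⟨hℓ.ne_zero⟩
  obtain ⟨a, haℓ, hra⟩ := hρprim.eq_pow_of_pow_eq_one hrbℓ
  have ha0 : (a : ZMod ℓ) ≠ 0 := by
    intro h
    rw [ZMod.natCast_eq_zero_iff] at h
    have : a = 0 := Nat.eq_zero_of_dvd_of_lt h haℓ
    rw [this, pow_zero] at hra
    exact hrb1 hra.symm
  set a' : ℕ := ((a : ZMod ℓ)⁻¹).val with ha'_def
  have haa' : (a * a') % ℓ = 1 := by
    have h : ((a * a' : ℕ) : ZMod ℓ) = ((1 : ℕ) : ZMod ℓ) := by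
      rw [Nat.cast_mul, ha'_def, ZMod.natCast_zmod_val, mul_inv_cancel₀ ha0, Nat.cast_one]
    rw [ZMod.natCast_eq_natCast_iff', Nat.mod_eq_of_lt hℓ.one_lt] at h
    exact h
  set ζu : ℂˣ := ((hζ.isUnit hℓ.ne_zero).unit) ^ a' with hζu_def
  have hζu_val : (ζu : ℂ) = ζ ^ a' := by rw [hζu_def, Units.val_pow_eq_pow_val]; rfl
  have hζu : ζu ∈ rootsOfUnity (Fintype.card (ZMod p)ˣ) ℂ := by
    rw [mem_rootsOfUnity', hcard, hζu_val, hn, ← pow_mul, mul_comm a', mul_assoc, pow_mul, hζℓ,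
      one_pow]
  set χ : MulChar (ZMod p) ℂ := MulChar.ofRootOfUnity hζu hg with hχ_def
  have hχg : χ (g : ZMod p) = ζ ^ a' := by
    rw [hχ_def, MulChar.ofRootOfUnity_spec hζu hg, hζu_val]
  have hlog : ∀ x : ZMod p, x ≠ 0 → ∃ j : ℕ, j < ℓ ∧ χ x = ζ ^ j ∧ x ^ n = rb ^ j := by
    intro x hx
    obtain ⟨m, hm⟩ := (Submonoid.mem_powers_iff _ _).1
      (((isOfFinOrder_of_finite g).mem_powers_iff_mem_zpowers).2 (hg (Units.mk0 x hx)))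
    have hxm : x = ((g ^ m : (ZMod p)ˣ) : ZMod p) := by rw [hm]; rfl
    refine ⟨(a' * m) % ℓ, Nat.mod_lt _ hℓ.pos, ?_, ?_⟩
    · rw [hxm, Units.val_pow_eq_pow_val, map_pow, hχg, ← pow_mul, pow_eq_pow_mod hζℓ]
    · rw [hxm, Units.val_pow_eq_pow_val]
      calc ((g : ZMod p) ^ m) ^ n = ρ ^ m := by rw [← pow_mul, mul_comm, pow_mul, hρ_def]
        _ = (ρ ^ a) ^ (a' * m) := by
            rw [← pow_mul, pow_eq_pow_mod hρℓ m, pow_eq_pow_mod hρℓ (a * (a' * m))]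
            congr 1
            symm
            rw [← mul_assoc, Nat.mul_mod, haa', one_mul, Nat.mod_mod]
        _ = rb ^ (a' * m % ℓ) := by rw [hra, ← pow_eq_pow_mod hrbℓ]
  have huniq : ∀ x : ZMod p, ∀ j j' : ℕ, j < ℓ → j' < ℓ → x ^ n = rb ^ j → x ^ n = rb ^ j' →
      j = j' := by
    intro x j j' hj hj' h1 h2
    exact hrbprim.pow_inj hj hj' (h1.symm.trans h2)
  have hζa'1 : ζ ^ a' ≠ 1 := by
    intro h
    have hdvd := (hζ.pow_eq_one_iff_dvd a').1 h
    have : (a * a') % ℓ = 0 := Nat.mod_eq_zero_of_dvd (dvd_mul_of_dvd_right hdvd a)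
    omega
  have hχ1 : χ ≠ 1 := by
    rw [Ne, MulChar.eq_iff hg, hχg, MulChar.one_apply_coe]
    exact hζa'1
  have hχℓ : χ ^ ℓ = 1 := by
    rw [MulChar.eq_iff hg, MulChar.pow_apply_coe, hχg, MulChar.one_apply_coe, ← pow_mul, mul_comm,
      pow_mul, hζℓ, one_pow]
  have hχneg : χ (-1) = 1 := by
    obtain ⟨j, hj, hχj, hnj⟩ := hlog (-1) (by rw [Ne, neg_eq_zero]; exact one_ne_zero)
    have h0 : (-1 : ZMod p) ^ n = rb ^ 0 := by rw [hneven.neg_one_pow, pow_zero]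
    rw [hχj, huniq (-1) j 0 hj hℓ.pos hnj h0, pow_zero]
  set ψ : AddChar (ZMod p) ℂ := ZMod.stdAddChar with hψ_def
  have hinner : ∀ x ∈ Finset.Icc 1 (p - 1),
      (∑ j ∈ Finset.range ℓ, if r ^ j % p = x ^ n % p then
        Complex.exp (2 * Real.pi * Complex.I * ((j : ℂ) / (ℓ : ℂ) + (x : ℂ) / (p : ℂ))) else 0) =
      χ (x : ZMod p) * ψ (x : ZMod p) := by
    intro x hx
    rw [Finset.mem_Icc] at hx
    have hx0 : (x : ZMod p) ≠ 0 := by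
      rw [Ne, ZMod.natCast_eq_zero_iff]
      exact Nat.not_dvd_of_pos_of_lt (by omega) (by omega)
    obtain ⟨j₀, hj₀, hχx, hxn⟩ := hlog (x : ZMod p) hx0
    have hcond : ∀ j : ℕ, j < ℓ → (r ^ j % p = x ^ n % p ↔ j = j₀) := by
      intro j hj
      rw [← ZMod.natCast_eq_natCast_iff', Nat.cast_pow, Nat.cast_pow]
      constructor
      · intro h
        exact huniq (x : ZMod p) j j₀ hj hj₀ h.symm hxn
      · rintro rfl
        exact hxn.symm
    rw [Finset.sum_eq_single j₀]
    · rw [if_pos ((hcond j₀ hj₀).2 rfl), hχx, hψ_def, stdAddChar_natCast, mul_add, Complex.exp_add,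
        ← Complex.exp_nat_mul]
      congr 2 <;> ring
    · intro j hj hne
      rw [Finset.mem_range] at hj
      rw [if_neg (mt (hcond j hj).1 hne)]
    · intro h
      exact absurd (Finset.mem_range.2 hj₀) h
  refine ⟨χ, hχ1, hχℓ, hχneg, ?_⟩
  rw [Finset.sum_congr rfl hinner, gaussSum, sum_zmod_eq_sum_range, Finset.range_eq_Ico,
    Finset.sum_eq_sum_Ico_succ_bot hp.pos, Nat.cast_zero, MulChar.map_zero, zero_mul, zero_add,
    zero_add, ← Finset.Ico_add_one_right_eq_Icc, Nat.sub_add_cancel hp.one_le]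

/-! ### The theorem -/

/-- **`GaussPowerNotReal`** (stmt-QuantumAdvantage-17352): for valid `(p, ℓ, r)`, `S^ℓ` is not
real. [Ireland–Rosen 1990, Ch. 8 §§2–3, Ch. 14 §3; Washington 1997, §6.1] -/
theorem gaussPowerNotReal_proof :
    Summit.QuantumAdvantage.QuantumAdvantage.Theses.StickelbergerGrid.GaussPowerNotReal := by
  unfold Summit.QuantumAdvantage.QuantumAdvantage.Theses.StickelbergerGrid.GaussPowerNotReal
  rintro p ℓ r ⟨hp, hℓ, hodd, hdiv, hrp, hrℓ, hr1⟩
  classical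
  haveI hpF : Fact p.Prime := ⟨hp⟩
  obtain ⟨χ, hχ1, hχℓ, hχneg, hS⟩ := exists_mulChar hℓ hodd hdiv hrp hrℓ hr1
  rw [hS]
  intro him
  -- numerics
  haveI hℓF : Fact ℓ.Prime := ⟨hℓ⟩
  haveI : NeZero ℓ := ⟨hℓ.ne_zero⟩
  have hℓ3 : 3 ≤ ℓ := by
    have h2 := hℓ.two_le
    rcases hodd with ⟨k, hk⟩
    omega
  obtain ⟨n, hn⟩ : ∃ n, p - 1 = ℓ * n := hdiv
  have hp2 := hp.two_le
  have hℓp : p % ℓ = 1 := by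
    have : p = 1 + ℓ * n := by omega
    rw [this, Nat.add_mul_mod_self_left, Nat.mod_eq_of_lt hℓ.one_lt]
  -- the two roots of unity and the ring `𝒪 = ℤ[ζ, ξ]`
  set ζ : ℂ := Complex.exp (2 * Real.pi * Complex.I / ℓ) with hζ_def
  have hζ : IsPrimitiveRoot ζ ℓ := Complex.isPrimitiveRoot_exp ℓ hℓ.ne_zero
  have hζℓ : ζ ^ ℓ = 1 := hζ.pow_eq_one
  set ξ : ℂ := Complex.exp (2 * Real.pi * Complex.I / p) with hξ_def
  have hξ : IsPrimitiveRoot ξ p := Complex.isPrimitiveRoot_exp p hp.ne_zero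
  set O : Subalgebra ℤ ℂ := Algebra.adjoin ℤ ({ζ, ξ} : Set ℂ) with hO_def
  have hζO : ζ ∈ O := Algebra.subset_adjoin (by simp)
  have hξO : ξ ∈ O := Algebra.subset_adjoin (by simp)
  have hZO : Algebra.adjoin ℤ ({ζ} : Set ℂ) ≤ O := Algebra.adjoin_mono (by simp)
  have hOint : O ≤ integralClosure ℤ ℂ := by
    refine Algebra.adjoin_le ?_
    intro z hz
    simp only [Set.mem_insert_iff, Set.mem_singleton_iff] at hz
    rcases hz with rfl | rfl
    · exact (mem_integralClosure_iff ℤ ℂ).2 (hζ.isIntegral hℓ.pos)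
    · exact (mem_integralClosure_iff ℤ ℂ).2 (hξ.isIntegral hp.pos)
  -- characters take values in `𝒪`
  set ψ : AddChar (ZMod p) ℂ := ZMod.stdAddChar with hψ_def
  have hψprim : ψ.IsPrimitive := ZMod.isPrimitive_stdAddChar p
  have hψO : ∀ x, ψ x ∈ O := fun x => by
    rw [hψ_def, stdAddChar_eq_pow]
    exact pow_mem hξO _
  have hψiO : ∀ x, ψ⁻¹ x ∈ O := fun x => by
    rw [AddChar.inv_apply]
    exact hψO _
  have hχvalO : ∀ (φ : MulChar (ZMod p) ℂ), φ ^ ℓ = 1 → ∀ x, φ x ∈ O := fun φ hφ x =>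
    hZO (MulChar.apply_mem_algebraAdjoin_of_pow_eq_one hφ hζ x)
  -- `χ² ≠ 1` and the powers
  set φ : MulChar (ZMod p) ℂ := χ * χ with hφ_def
  have hordχ : orderOf χ = ℓ := orderOf_eq_prime hχℓ hχ1
  have hφ1 : φ ≠ 1 := by
    intro h
    have h2 : χ ^ 2 = 1 := by rw [sq]; exact h
    have hdvd : ℓ ∣ 2 := by rw [← hordχ]; exact orderOf_dvd_of_pow_eq_one h2
    have := Nat.le_of_dvd two_pos hdvd
    omega
  have hφℓ : φ ^ ℓ = 1 := by rw [hφ_def, mul_pow, hχℓ, one_mul]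
  have hφiℓ : φ⁻¹ ^ ℓ = 1 := by rw [inv_pow, hφℓ, inv_one]
  have hφi1 : φ⁻¹ ≠ 1 := fun h => hφ1 (inv_eq_one.1 h)
  have hχiℓ : χ⁻¹ ^ ℓ = 1 := by rw [inv_pow, hχℓ, inv_one]
  -- the players
  set S : ℂ := gaussSum χ ψ with hS_def
  set G : ℂ := gaussSum φ ψ with hG_def
  set H : ℂ := gaussSum φ⁻¹ ψ⁻¹ with hH_def
  set J : ℂ := jacobiSum χ χ with hJ_def
  set J' : ℂ := jacobiSum χ⁻¹ χ⁻¹ with hJ'_def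
  have hcardF : (Fintype.card (ZMod p) : ℂ) = p := by rw [ZMod.card]
  have hSS : S * gaussSum χ⁻¹ ψ⁻¹ = p := by
    rw [hS_def, gaussSum_mul_gaussSum_eq_card hχ1 hψprim, hcardF]
  have hGH : G * H = p := by
    rw [hG_def, hH_def, gaussSum_mul_gaussSum_eq_card hφ1 hψprim, hcardF]
  have hchar : ringChar ℂ ≠ ringChar (ZMod p) := by
    rw [ringChar.eq_zero, ZMod.ringChar_zmod_n]
    exact hp.ne_zero.symm
  have hJJ : J * J' = p := by
    rw [hJ_def, hJ'_def, jacobiSum_mul_jacobiSum_inv hchar hχ1 hχ1 hφ1, hcardF]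
  have hS2 : S * S = J * G := by
    rw [hS_def, hJ_def, hG_def, hφ_def, ← jacobiSum_mul_nontrivial hφ1 ψ, mul_comm]
  have hp0 : (p : ℂ) ≠ 0 := by exact_mod_cast hp.ne_zero
  have hJ0 : J ≠ 0 := fun h => hp0 (by rw [← hJJ, h, zero_mul])
  have hJ'0 : J' ≠ 0 := fun h => hp0 (by rw [← hJJ, h, mul_zero])
  -- from `Im S^ℓ = 0`: `(S^ℓ)² = p^ℓ`, so `S² = ζ^k p`
  have hconj : starRingEnd ℂ S = gaussSum χ⁻¹ ψ⁻¹ := by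
    rw [← star_gaussSum_eq, RCLike.star_def]
  have hreal : starRingEnd ℂ (S ^ ℓ) = S ^ ℓ := Complex.conj_eq_iff_im.2 him
  have hsq : (S ^ ℓ) ^ 2 = (p : ℂ) ^ ℓ := by
    calc (S ^ ℓ) ^ 2 = S ^ ℓ * starRingEnd ℂ (S ^ ℓ) := by rw [hreal, sq]
      _ = (S * gaussSum χ⁻¹ ψ⁻¹) ^ ℓ := by rw [map_pow, hconj, mul_pow]
      _ = (p : ℂ) ^ ℓ := by rw [hSS]
  have hu : (S ^ 2 / p) ^ ℓ = 1 := by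
    rw [div_pow, ← pow_mul, mul_comm, pow_mul, hsq, div_self (pow_ne_zero _ hp0)]
  obtain ⟨k, _, hk⟩ := hζ.eq_pow_of_pow_eq_one hu
  have hS2' : S ^ 2 = ζ ^ k * p := by
    rw [hk, div_mul_cancel₀ _ hp0]
  -- `G = ζ^k J'` and `H = ζ^(ℓ-k) J`, both in `ℤ[ζ]`
  have hG : G = ζ ^ k * J' := by
    have h : J * G = J * (ζ ^ k * J') := by
      rw [← hS2, ← sq, hS2', ← hJJ]; ring
    exact mul_left_cancel₀ hJ0 h
  have hk' : ζ ^ (ℓ - k) * ζ ^ k = 1 := by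
    rw [← pow_add, Nat.sub_add_cancel (by omega), hζℓ]
  have hH : H = ζ ^ (ℓ - k) * J := by
    have h : G * H = G * (ζ ^ (ℓ - k) * J) := by
      rw [hGH, ← hJJ, hG]
      linear_combination (-(J * J')) * hk'
    have hG0 : G ≠ 0 := fun h0 => hp0 (by rw [← hGH, h0, zero_mul])
    exact mul_left_cancel₀ hG0 h
  have hJ'mem : J' ∈ Algebra.adjoin ℤ ({ζ} : Set ℂ) :=
    jacobiSum_mem_algebraAdjoin_of_pow_eq_one hχiℓ hχiℓ hζ
  have hJmem : J ∈ Algebra.adjoin ℤ ({ζ} : Set ℂ) :=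
    jacobiSum_mem_algebraAdjoin_of_pow_eq_one hχℓ hχℓ hζ
  have hζZ : ζ ∈ Algebra.adjoin ℤ ({ζ} : Set ℂ) := Algebra.self_mem_adjoin_singleton ℤ ζ
  have hGmem : G ∈ Algebra.adjoin ℤ ({ζ} : Set ℂ) := by
    rw [hG]; exact mul_mem (pow_mem hζZ _) hJ'mem
  have hHmem : H ∈ Algebra.adjoin ℤ ({ζ} : Set ℂ) := by
    rw [hH]; exact mul_mem (pow_mem hζZ _) hJmem
  -- Frobenius: `G, H ∈ p𝒪`
  obtain ⟨w, hw, hGw⟩ := gaussSum_mem_of_mem_adjoin hℓ hℓp hζ hζO hφ1 hφℓ (hχvalO φ hφℓ) hψO hGmem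
  obtain ⟨w', hw', hHw⟩ :=
    gaussSum_mem_of_mem_adjoin hℓ hℓp hζ hζO hφi1 hφiℓ (hχvalO φ⁻¹ hφiℓ) hψiO hHmem
  -- `1/p = w w' ∈ 𝒪`: contradiction
  apply inv_not_mem hp hOint
  have hinv : ((p : ℂ))⁻¹ = w * w' := by
    have h : (p : ℂ) * (p * (w * w')) = (p : ℂ) * 1 := by
      rw [mul_one]
      calc (p : ℂ) * (p * (w * w')) = (p * w) * (p * w') := by ring
        _ = G * H := by rw [hG_def, hH_def, hGw, hHw]
        _ = p := hGH
    exact inv_eq_of_mul_eq_one_right (mul_left_cancel₀ hp0 h)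
  rw [hinv]
  exact mul_mem hw hw'

end Summit.QuantumAdvantage.QuantumAdvantage.Theorems.GaussPowerNotReal
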